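import Summits.QuantumFields.GaugeBoot.TiltedBoxAxisRPNegative
import Summits.QuantumFields.GaugeBoot.TiltedBoxOddMidAxisRPNegative
import Summits.QuantumFields.GaugeBoot.TiltedBoxEvenMidAxisRPNegative
import Summits.QuantumFields.GaugeBoot.TiltedBoxOddAxisRPTwoDimBlocks
import Summits.QuantumFields.GaugeBoot.TiltedBoxEvenMidAxisRPTwoDimBlocks
import Summits.QuantumFields.GaugeBoot.TiltedBoxEvenAxisRPTwoDim
import Summits.QuantumFields.GaugeBoot.TiltedBoxRedSiteRPNegative
import Summits.QuantumFields.GaugeBoot.TiltedBoxRedLinkRPNegative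
import Summits.QuantumFields.GaugeBoot.TiltedBoxOddMidAxisRPTwoDim
import HarnessLib

/-!
# The in-plane mirrors of the square 45°-tilted boxes: classification summary (gauge-boot, L3 supplement)

HONEST FRAMING (cell `pub-gaugeboot`, page 1 of every file): the venture produces certified bounds
on lattice expectations at stated coupling, gauge group, dimension and torus size; NOT a mass gap,
NOT a continuum limit, NOT a string tension; NOT Yang–Mills-summit-bearing (barriers
`FixedCouplingUltralocality`, `PerturbativeInvisibility`). One conjunction per dimension regime of
results proved in the files imported above, for citation; nothing new is proved and no expectation
of the venture's tables is bounded here.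

## Content

On the square tilted box `ℤ^d/Γ(M, M, L)` of the plane `(i, j)` the in-plane axis mirrors
`x_i ↦ c - x_i` are symmetries of the Wilson measure (`tiltedBox_integral_comp_flip`). As candidate
REFLECTION POSITIVITIES (PSD row blocks of a loop-equation SDP) they come in four classes, according
to the parity of `M` and to whether the mirror passes through sites (`configReflect`, `x_i ↦ -x_i`)
or through links (`configMidReflect`, `x_i ↦ 1 - x_i`); in each class one of the two fixed
hyperplanes of the mirror is met by the box "half-way round", where the identification by `Γ`
twists it by the half-period translation `T`:

| class | box | mirror | twisted object | verdict |
|---|---|---|---|---|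
| (L1) | `M = 2P` | sites, half `{0 ≤ x_i ≤ P}` | the LAYER `x_i = P` | fails, every `d ≥ 2`, every `β` |
| (L2) | `M = 2P+1` | links, half `{1 ≤ x_i ≤ P+1}` | the LAYER `x_i = P+1` | fails, every `d ≥ 2`, every `β` |
| (S1) | `M = 2P+1` | sites, half `{0 ≤ x_i ≤ P}` | the SLAB `P ∣ P+1` | fails in `d ≥ 3` (`β > 0`); HOLDS in `d = 2` (every `β`) |
| (S2) | `M = 2P`, `P ≥ 2` | links, half `{1 ≤ x_i ≤ P}` | the SLAB `P ∣ P+1` | fails in `d ≥ 3` (`β > 0`); HOLDS in `d = 2` (every `β`) |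

(L1) `not_tiltedBox_axisRP` (`TiltedBoxAxisRPNegative.lean`), (L2) `not_tiltedBox_midAxisRP_odd`
(`TiltedBoxOddMidAxisRPNegative.lean`) — a twisted layer carries an observable odd under the mirror;
(S1) `not_tiltedBox_axisRP_odd` / `TwoDim.tiltedBox_axisRP_odd_twoDim`, (S2) `not_tiltedBox_midAxisRP` /
`TwoDim.tiltedBox_midAxisRP_twoDim` — in `d ≥ 3` a transverse plaquette pair straddling the twisted
slab is a witness (irreducible non-trivial `ρ`), in `d = 2` the slab is an annulus whose
class-averaged convolution-square kernel is of positive type (2D Yang–Mills gluing).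

* **`inPlaneMirrors_of_transverse_axis`** — the `d ≥ 3` row of the table (a third axis
  `k ∉ {i, j}`, `L ≥ 2`): all four classes fail (the layer classes at every real `β` for every
  non-trivial `G`; the slab classes for `β > 0`, `ρ` continuous, non-trivial, with scalar commutant);
* **`inPlaneMirrors_twoDim`** — the `d = 2` row (`∀ k, k = i ∨ k = j`): the layer classes fail and
  the slab classes hold, at every real `β`;
* **`inPlaneMirrors_of_transverse_axis_suN`**, **`inPlaneMirrors_twoDim_suN`** — the same for the
  venture's `SU(N)` lattice Yang–Mills theory (`N ≥ 2`, fundamental representation);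
* (appended, gen 51) **`inPlaneMirrors_reducedSite_suN`** — the REDUCED half `{0 ≤ x_i ≤ P - 1}` of
  class (L1) (the twisted layer `x_i = P` left free; links `TwoDim.IsRedSiteLink`): for `SU(N)` it
  HOLDS in `d = 2` at every real `β` (`TwoDim.tiltedBox_axisRP_even_twoDim`, gen 50) and FAILS with a
  transverse axis `k ∉ {i, j}` (`d ≥ 3`) for all sufficiently small `β > 0`
  (`RedSite.not_tiltedBox_axisRP_even_red_specialUnitary_of_axis`: a length-two strong-coupling tube
  through the free layer, order `β⁸`; `β₀` depends on the box);
* (appended, gen 51) **`inPlaneMirrors_reducedLink_suN`** — likewise the REDUCED half `{1 ≤ x_i ≤ P}`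
  of class (L2) (the twisted layer `x_i = P + 1` left free; links `TwoDim.IsRedLink`): for `SU(N)` it
  HOLDS in `d = 2` at every real `β` (`TwoDim.tiltedBox_midAxisRP_odd_twoDim`, gen 50) and FAILS with a
  transverse axis (`d ≥ 3`) for all sufficiently small `β > 0`
  (`RedLink.not_tiltedBox_midAxisRP_odd_red_specialUnitary_of_axis`, the same tube mechanism).

So: in `d ≥ 3` NO in-plane axis mirror of a square tilted box is a PSD block (the cone of the box is
`H`, translations, `R_diag`, `R_antidiag`, `R_site(k)`/`R_link(k)` for `k ∉ {i, j}`); in `d = 2` the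
two slab-type mirrors ARE PSD blocks (`TwoDim.tiltedBox_axisRP_odd_twoDim_blocks`,
`TwoDim.tiltedBox_midAxisRP_twoDim_blocks`). Not covered: the even box of side `2` for (S2)
(`P = 1`, excluded on both sides), non-square boxes (the in-plane flips are then not symmetries of
`Γ`, `TiltedBoxAxisFlips.lean`).

References: K. Osterwalder, E. Seiler, Ann. Phys. 110 (1978) 440, §2; J. Fröhlich, R. Israel,
E. H. Lieb, B. Simon, J. Stat. Phys. 22 (1980) 297, §3; A. A. Migdal, Sov. Phys. JETP 42 (1975) 413
(2D recursion); V. Kazakov, Z. Zheng, arXiv:2203.11360 §3.1.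
-/

noncomputable section

open MeasureTheory Complex Matrix
open scoped ComplexOrder ComplexConjugate
open Literature.MathematicalPhysics.QuantumLattice

namespace Summit.QuantumFields.GaugeBoot

namespace TiltedRP

/-! ## General compact gauge group -/

section General

variable {d : ℕ} {i j k : Fin d} {L P N : ℕ} [NeZero L] [NeZero P]
variable {G : Type*} [Group G] [TopologicalSpace G] [IsTopologicalGroup G] [CompactSpace G]
  [MeasurableSpace G] [BorelSpace G] [SecondCountableTopology G]
variable (ρ : G →* Matrix (Fin N) (Fin N) ℂ)

/-- **`d ≥ 3`: all four in-plane mirror classes fail.** Box data: plane `(i, j)`, `i ≠ j`, a third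
axis `k ∉ {i, j}`, transverse period `L ≥ 2`, side parameter `P ≥ 1` (`P ≥ 2` for (S2)); `G`
non-trivial compact Hausdorff second countable, `ρ` continuous with scalar commutant, `N ≥ 1`,
`ρ ≠ 1`; `β > 0`. Conjuncts in the order (L1), (L2), (S1), (S2) of the module docstring. -/
theorem inPlaneMirrors_of_transverse_axis [Nontrivial G] [T2Space G] (hij : i ≠ j) (hki : k ≠ i)
    (hkj : k ≠ j) (hL : 2 ≤ L) (hP : 2 ≤ P) (hρ : Continuous ρ)
    (hirr : TwistedSlab.HasScalarCommutant ρ) (hN : 1 ≤ N) (hρ1 : ∃ g, ρ g ≠ 1) {β : ℝ}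
    (hβ : 0 < β) :
    -- (L1) even box, site mirror, twisted layer
    (¬ ∀ F : Config (TiltedSite d i j (2 * P) (2 * P) L) d G → ℂ, Measurable F →
        (∃ C : ℝ, ∀ U, ‖F U‖ ≤ C) →
        IsHalfObservable (tiltedUnit d i j (2 * P) (2 * P) L) P (tiltedAxisCoord d L P) F →
        0 ≤ ∫ U, conj (F (configReflect (tiltedUnit d i j (2 * P) (2 * P) L) i
          (tiltedAxisFlip d L (2 * P) hij) U)) * F U ∂(gibbs ρ (tiltedUnit d i j (2 * P) (2 * P) L) β)) ∧
    -- (L2) odd box, link mirror, twisted layer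
    (¬ ∀ F : Config (TiltedSite d i j (2 * P + 1) (2 * P + 1) L) d G → ℂ, Measurable F →
        (∃ C : ℝ, ∀ U, ‖F U‖ ≤ C) →
        (∀ U V : Config (TiltedSite d i j (2 * P + 1) (2 * P + 1) L) d G,
          (∀ l : Link (TiltedSite d i j (2 * P + 1) (2 * P + 1) L) d,
            (1 ≤ (axisCoord d L (2 * P + 1) l.1).val ∧ (axisCoord d L (2 * P + 1) l.1).val ≤ P + 1) →
            (1 ≤ (axisCoord d L (2 * P + 1) (l.1 + tiltedUnit d i j (2 * P + 1) (2 * P + 1) L l.2)).val ∧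
              (axisCoord d L (2 * P + 1) (l.1 + tiltedUnit d i j (2 * P + 1) (2 * P + 1) L l.2)).val ≤ P + 1) →
            U l = V l) → F U = F V) →
        0 ≤ ∫ U, conj (F (configMidReflect (tiltedUnit d i j (2 * P + 1) (2 * P + 1) L) i
          (tiltedAxisFlip d L (2 * P + 1) hij) U)) * F U
          ∂(gibbs ρ (tiltedUnit d i j (2 * P + 1) (2 * P + 1) L) β)) ∧
    -- (S1) odd box, site mirror, twisted slab
    (¬ ∀ F : Config (TiltedSite d i j (2 * P + 1) (2 * P + 1) L) d G → ℂ, Measurable F →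
        (∃ C : ℝ, ∀ U, ‖F U‖ ≤ C) →
        IsHalfObservable (tiltedUnit d i j (2 * P + 1) (2 * P + 1) L) (2 * P + 1) (axisHeight2 d L (2 * P + 1)) F →
        0 ≤ ∫ U, conj (F (configReflect (tiltedUnit d i j (2 * P + 1) (2 * P + 1) L) i
          (tiltedAxisFlip d L (2 * P + 1) hij) U)) * F U
          ∂(gibbs ρ (tiltedUnit d i j (2 * P + 1) (2 * P + 1) L) β)) ∧
    -- (S2) even box (`P ≥ 2`), link mirror, twisted slab
    (¬ ∀ F : Config (TiltedSite d i j (2 * P) (2 * P) L) d G → ℂ, Measurable F →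
        (∃ C : ℝ, ∀ U, ‖F U‖ ≤ C) →
        IsMidObservable (tiltedUnit d i j (2 * P) (2 * P) L) P (axisCoord d L (2 * P)) F →
        0 ≤ ∫ U, conj (F (configMidReflect (tiltedUnit d i j (2 * P) (2 * P) L) i
          (tiltedAxisFlip d L (2 * P) hij) U)) * F U
          ∂(gibbs ρ (tiltedUnit d i j (2 * P) (2 * P) L) β)) :=
  ⟨not_tiltedBox_axisRP ρ hij hρ β,
    not_tiltedBox_midAxisRP_odd ρ hij hρ β,
    not_tiltedBox_axisRP_odd ρ hij hki hkj hL hρ hirr hN hρ1 hβ,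
    not_tiltedBox_midAxisRP ρ hP hij hki hkj hL hρ hirr hN hρ1 hβ⟩

/-- **`d = 2`: the layer classes fail, the slab classes hold.** Box data: the two axes `i ≠ j`
exhaust `Fin d`, `P ≥ 1` (`P ≥ 2` for (S2)); `G` non-trivial compact Hausdorff second countable,
`ρ` continuous; EVERY real `β`. Conjuncts in the order (L1), (L2), (S1), (S2). -/
theorem inPlaneMirrors_twoDim [Nontrivial G] [T2Space G] (hij : i ≠ j)
    (hd : ∀ k : Fin d, k = i ∨ k = j) (hP : 2 ≤ P) (hρ : Continuous ρ) (β : ℝ) :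
    -- (L1) even box, site mirror, twisted layer: fails
    (¬ ∀ F : Config (TiltedSite d i j (2 * P) (2 * P) L) d G → ℂ, Measurable F →
        (∃ C : ℝ, ∀ U, ‖F U‖ ≤ C) →
        IsHalfObservable (tiltedUnit d i j (2 * P) (2 * P) L) P (tiltedAxisCoord d L P) F →
        0 ≤ ∫ U, conj (F (configReflect (tiltedUnit d i j (2 * P) (2 * P) L) i
          (tiltedAxisFlip d L (2 * P) hij) U)) * F U ∂(gibbs ρ (tiltedUnit d i j (2 * P) (2 * P) L) β)) ∧
    -- (L2) odd box, link mirror, twisted layer: fails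
    (¬ ∀ F : Config (TiltedSite d i j (2 * P + 1) (2 * P + 1) L) d G → ℂ, Measurable F →
        (∃ C : ℝ, ∀ U, ‖F U‖ ≤ C) →
        (∀ U V : Config (TiltedSite d i j (2 * P + 1) (2 * P + 1) L) d G,
          (∀ l : Link (TiltedSite d i j (2 * P + 1) (2 * P + 1) L) d,
            (1 ≤ (axisCoord d L (2 * P + 1) l.1).val ∧ (axisCoord d L (2 * P + 1) l.1).val ≤ P + 1) →
            (1 ≤ (axisCoord d L (2 * P + 1) (l.1 + tiltedUnit d i j (2 * P + 1) (2 * P + 1) L l.2)).val ∧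
              (axisCoord d L (2 * P + 1) (l.1 + tiltedUnit d i j (2 * P + 1) (2 * P + 1) L l.2)).val ≤ P + 1) →
            U l = V l) → F U = F V) →
        0 ≤ ∫ U, conj (F (configMidReflect (tiltedUnit d i j (2 * P + 1) (2 * P + 1) L) i
          (tiltedAxisFlip d L (2 * P + 1) hij) U)) * F U
          ∂(gibbs ρ (tiltedUnit d i j (2 * P + 1) (2 * P + 1) L) β)) ∧
    -- (S1) odd box, site mirror, twisted slab: HOLDS
    (∀ F : Config (TiltedSite d i j (2 * P + 1) (2 * P + 1) L) d G → ℂ, Measurable F →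
        (∃ C : ℝ, ∀ U, ‖F U‖ ≤ C) →
        IsHalfObservable (tiltedUnit d i j (2 * P + 1) (2 * P + 1) L) (2 * P + 1) (axisHeight2 d L (2 * P + 1)) F →
        0 ≤ ∫ U, conj (F (configReflect (tiltedUnit d i j (2 * P + 1) (2 * P + 1) L) i
          (tiltedAxisFlip d L (2 * P + 1) hij) U)) * F U
          ∂(gibbs ρ (tiltedUnit d i j (2 * P + 1) (2 * P + 1) L) β)) ∧
    -- (S2) even box (`P ≥ 2`), link mirror, twisted slab: HOLDS
    (∀ F : Config (TiltedSite d i j (2 * P) (2 * P) L) d G → ℂ, Measurable F →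
        (∃ C : ℝ, ∀ U, ‖F U‖ ≤ C) →
        IsMidObservable (tiltedUnit d i j (2 * P) (2 * P) L) P (axisCoord d L (2 * P)) F →
        0 ≤ ∫ U, conj (F (configMidReflect (tiltedUnit d i j (2 * P) (2 * P) L) i
          (tiltedAxisFlip d L (2 * P) hij) U)) * F U
          ∂(gibbs ρ (tiltedUnit d i j (2 * P) (2 * P) L) β)) :=
  ⟨not_tiltedBox_axisRP ρ hij hρ β,
    not_tiltedBox_midAxisRP_odd ρ hij hρ β,
    fun F hFm hFb hFo => TwoDim.tiltedBox_axisRP_odd_twoDim ρ hij hd hρ β F hFm hFb hFo,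
    fun F hFm hFb hFo => TwoDim.tiltedBox_midAxisRP_twoDim ρ hP hij hd hρ β F hFm hFb hFo⟩

end General

/-! ## The venture's gauge group `SU(N)` -/

section SpecialUnitary

variable {d : ℕ} {i j k : Fin d} {L P N : ℕ} [NeZero L] [NeZero P]

/-- **`SU(N)` lattice Yang–Mills, `d ≥ 3`: all four in-plane mirror classes fail** (`N ≥ 2`,
fundamental representation, `k ∉ {i, j}`, `L ≥ 2`, `P ≥ 2`, `β > 0`). [folklore] -/
theorem inPlaneMirrors_of_transverse_axis_suN (hij : i ≠ j) (hki : k ≠ i) (hkj : k ≠ j)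
    (hL : 2 ≤ L) (hP : 2 ≤ P) (hN : 2 ≤ N) {β : ℝ} (hβ : 0 < β) :
    (¬ ∀ F : Config (TiltedSite d i j (2 * P) (2 * P) L) d (specialUnitaryGroup (Fin N) ℂ) → ℂ,
        Measurable F → (∃ C : ℝ, ∀ U, ‖F U‖ ≤ C) →
        IsHalfObservable (tiltedUnit d i j (2 * P) (2 * P) L) P (tiltedAxisCoord d L P) F →
        0 ≤ ∫ U, conj (F (configReflect (tiltedUnit d i j (2 * P) (2 * P) L) i
          (tiltedAxisFlip d L (2 * P) hij) U)) * F U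
          ∂(gibbs (fundamentalRep (Fin N)) (tiltedUnit d i j (2 * P) (2 * P) L) β)) ∧
    (¬ ∀ F : Config (TiltedSite d i j (2 * P + 1) (2 * P + 1) L) d (specialUnitaryGroup (Fin N) ℂ) → ℂ,
        Measurable F → (∃ C : ℝ, ∀ U, ‖F U‖ ≤ C) →
        (∀ U V : Config (TiltedSite d i j (2 * P + 1) (2 * P + 1) L) d (specialUnitaryGroup (Fin N) ℂ),
          (∀ l : Link (TiltedSite d i j (2 * P + 1) (2 * P + 1) L) d,
            (1 ≤ (axisCoord d L (2 * P + 1) l.1).val ∧ (axisCoord d L (2 * P + 1) l.1).val ≤ P + 1) →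
            (1 ≤ (axisCoord d L (2 * P + 1) (l.1 + tiltedUnit d i j (2 * P + 1) (2 * P + 1) L l.2)).val ∧
              (axisCoord d L (2 * P + 1) (l.1 + tiltedUnit d i j (2 * P + 1) (2 * P + 1) L l.2)).val ≤ P + 1) →
            U l = V l) → F U = F V) →
        0 ≤ ∫ U, conj (F (configMidReflect (tiltedUnit d i j (2 * P + 1) (2 * P + 1) L) i
          (tiltedAxisFlip d L (2 * P + 1) hij) U)) * F U
          ∂(gibbs (fundamentalRep (Fin N)) (tiltedUnit d i j (2 * P + 1) (2 * P + 1) L) β)) ∧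
    (¬ ∀ F : Config (TiltedSite d i j (2 * P + 1) (2 * P + 1) L) d (specialUnitaryGroup (Fin N) ℂ) → ℂ,
        Measurable F → (∃ C : ℝ, ∀ U, ‖F U‖ ≤ C) →
        IsHalfObservable (tiltedUnit d i j (2 * P + 1) (2 * P + 1) L) (2 * P + 1) (axisHeight2 d L (2 * P + 1)) F →
        0 ≤ ∫ U, conj (F (configReflect (tiltedUnit d i j (2 * P + 1) (2 * P + 1) L) i
          (tiltedAxisFlip d L (2 * P + 1) hij) U)) * F U
          ∂(gibbs (fundamentalRep (Fin N)) (tiltedUnit d i j (2 * P + 1) (2 * P + 1) L) β)) ∧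
    (¬ ∀ F : Config (TiltedSite d i j (2 * P) (2 * P) L) d (specialUnitaryGroup (Fin N) ℂ) → ℂ,
        Measurable F → (∃ C : ℝ, ∀ U, ‖F U‖ ≤ C) →
        IsMidObservable (tiltedUnit d i j (2 * P) (2 * P) L) P (axisCoord d L (2 * P)) F →
        0 ≤ ∫ U, conj (F (configMidReflect (tiltedUnit d i j (2 * P) (2 * P) L) i
          (tiltedAxisFlip d L (2 * P) hij) U)) * F U
          ∂(gibbs (fundamentalRep (Fin N)) (tiltedUnit d i j (2 * P) (2 * P) L) β)) := by
  haveI : SecondCountableTopology (Matrix (Fin N) (Fin N) ℂ) :=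
    inferInstanceAs (SecondCountableTopology (Fin N → Fin N → ℂ))
  haveI : SecondCountableTopology (specialUnitaryGroup (Fin N) ℂ) :=
    Topology.IsEmbedding.subtypeVal.secondCountableTopology
  haveI : Nontrivial (specialUnitaryGroup (Fin N) ℂ) := by
    obtain ⟨g, hg⟩ := exists_fundamentalRep_ne_one hN
    exact nontrivial_of_ne g 1 fun h => hg (by rw [h, map_one])
  exact inPlaneMirrors_of_transverse_axis (fundamentalRep (Fin N)) hij hki hkj hL hP
    (continuous_fundamentalRep (Fin N)) hasScalarCommutant_fundamentalRep (by omega)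
    (exists_fundamentalRep_ne_one hN) hβ

/-- **`SU(N)` lattice Yang–Mills, `d = 2`: the layer classes fail, the slab classes hold** (`N ≥ 2`,
fundamental representation, the two axes exhaust `Fin d`, `P ≥ 2`, every real `β`). [folklore] -/
theorem inPlaneMirrors_twoDim_suN (hij : i ≠ j) (hd : ∀ k : Fin d, k = i ∨ k = j) (hP : 2 ≤ P)
    (hN : 2 ≤ N) (β : ℝ) :
    (¬ ∀ F : Config (TiltedSite d i j (2 * P) (2 * P) L) d (specialUnitaryGroup (Fin N) ℂ) → ℂ,
        Measurable F → (∃ C : ℝ, ∀ U, ‖F U‖ ≤ C) →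
        IsHalfObservable (tiltedUnit d i j (2 * P) (2 * P) L) P (tiltedAxisCoord d L P) F →
        0 ≤ ∫ U, conj (F (configReflect (tiltedUnit d i j (2 * P) (2 * P) L) i
          (tiltedAxisFlip d L (2 * P) hij) U)) * F U
          ∂(gibbs (fundamentalRep (Fin N)) (tiltedUnit d i j (2 * P) (2 * P) L) β)) ∧
    (¬ ∀ F : Config (TiltedSite d i j (2 * P + 1) (2 * P + 1) L) d (specialUnitaryGroup (Fin N) ℂ) → ℂ,
        Measurable F → (∃ C : ℝ, ∀ U, ‖F U‖ ≤ C) →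
        (∀ U V : Config (TiltedSite d i j (2 * P + 1) (2 * P + 1) L) d (specialUnitaryGroup (Fin N) ℂ),
          (∀ l : Link (TiltedSite d i j (2 * P + 1) (2 * P + 1) L) d,
            (1 ≤ (axisCoord d L (2 * P + 1) l.1).val ∧ (axisCoord d L (2 * P + 1) l.1).val ≤ P + 1) →
            (1 ≤ (axisCoord d L (2 * P + 1) (l.1 + tiltedUnit d i j (2 * P + 1) (2 * P + 1) L l.2)).val ∧
              (axisCoord d L (2 * P + 1) (l.1 + tiltedUnit d i j (2 * P + 1) (2 * P + 1) L l.2)).val ≤ P + 1) →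
            U l = V l) → F U = F V) →
        0 ≤ ∫ U, conj (F (configMidReflect (tiltedUnit d i j (2 * P + 1) (2 * P + 1) L) i
          (tiltedAxisFlip d L (2 * P + 1) hij) U)) * F U
          ∂(gibbs (fundamentalRep (Fin N)) (tiltedUnit d i j (2 * P + 1) (2 * P + 1) L) β)) ∧
    (∀ F : Config (TiltedSite d i j (2 * P + 1) (2 * P + 1) L) d (specialUnitaryGroup (Fin N) ℂ) → ℂ,
        Measurable F → (∃ C : ℝ, ∀ U, ‖F U‖ ≤ C) →
        IsHalfObservable (tiltedUnit d i j (2 * P + 1) (2 * P + 1) L) (2 * P + 1) (axisHeight2 d L (2 * P + 1)) F →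
        0 ≤ ∫ U, conj (F (configReflect (tiltedUnit d i j (2 * P + 1) (2 * P + 1) L) i
          (tiltedAxisFlip d L (2 * P + 1) hij) U)) * F U
          ∂(gibbs (fundamentalRep (Fin N)) (tiltedUnit d i j (2 * P + 1) (2 * P + 1) L) β)) ∧
    (∀ F : Config (TiltedSite d i j (2 * P) (2 * P) L) d (specialUnitaryGroup (Fin N) ℂ) → ℂ,
        Measurable F → (∃ C : ℝ, ∀ U, ‖F U‖ ≤ C) →
        IsMidObservable (tiltedUnit d i j (2 * P) (2 * P) L) P (axisCoord d L (2 * P)) F →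
        0 ≤ ∫ U, conj (F (configMidReflect (tiltedUnit d i j (2 * P) (2 * P) L) i
          (tiltedAxisFlip d L (2 * P) hij) U)) * F U
          ∂(gibbs (fundamentalRep (Fin N)) (tiltedUnit d i j (2 * P) (2 * P) L) β)) := by
  haveI : SecondCountableTopology (Matrix (Fin N) (Fin N) ℂ) :=
    inferInstanceAs (SecondCountableTopology (Fin N → Fin N → ℂ))
  haveI : SecondCountableTopology (specialUnitaryGroup (Fin N) ℂ) :=
    Topology.IsEmbedding.subtypeVal.secondCountableTopology
  haveI : Nontrivial (specialUnitaryGroup (Fin N) ℂ) := by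
    obtain ⟨g, hg⟩ := exists_fundamentalRep_ne_one hN
    exact nontrivial_of_ne g 1 fun h => hg (by rw [h, map_one])
  exact inPlaneMirrors_twoDim (fundamentalRep (Fin N)) hij hd hP (continuous_fundamentalRep (Fin N)) β

end SpecialUnitary

/-! ## The reduced half of the site mirror of the even box (appended, gen 51) -/

section ReducedSite

variable {d : ℕ} {i j : Fin d} {L P N : ℕ} [NeZero L] [NeZero P]

/-- **`SU(N)` lattice Yang–Mills, the REDUCED half `{0 ≤ x_i ≤ P - 1}` of the site mirror of the even
box** (`N ≥ 2`, `P ≥ 2`): in `d = 2` (the two axes exhaust `Fin d`) reflection positivity HOLDS at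
every real `β`; with a transverse axis `k ∉ {i, j}` (`d ≥ 3`) and `L ≥ 2` it FAILS for all
sufficiently small `β > 0`. [folklore] -/
theorem inPlaneMirrors_reducedSite_suN (hij : i ≠ j) (hP : 2 ≤ P) (hN : 2 ≤ N) :
    ((∀ k : Fin d, k = i ∨ k = j) → ∀ (β : ℝ)
      (F : Config (TiltedSite d i j (2 * P) (2 * P) L) d (specialUnitaryGroup (Fin N) ℂ) → ℂ), Measurable F →
        (∃ C : ℝ, ∀ U, ‖F U‖ ≤ C) →
        (∀ U V : Config (TiltedSite d i j (2 * P) (2 * P) L) d (specialUnitaryGroup (Fin N) ℂ),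
          (∀ l, TwoDim.IsRedSiteLink (P := P) l → U l = V l) → F U = F V) →
        0 ≤ ∫ U, conj (F (configReflect (tiltedUnit d i j (2 * P) (2 * P) L) i
          (tiltedAxisFlip d L (2 * P) hij) U)) * F U
          ∂(gibbs (fundamentalRep (Fin N)) (tiltedUnit d i j (2 * P) (2 * P) L) β)) ∧
    (∀ k : Fin d, k ≠ i → k ≠ j → 2 ≤ L →
      ∃ β₀ : ℝ, 0 < β₀ ∧ ∀ β : ℝ, 0 < β → β ≤ β₀ →
        ¬ ∀ F : Config (TiltedSite d i j (2 * P) (2 * P) L) d (specialUnitaryGroup (Fin N) ℂ) → ℂ, Measurable F →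
          (∃ C : ℝ, ∀ U, ‖F U‖ ≤ C) →
          (∀ U V : Config (TiltedSite d i j (2 * P) (2 * P) L) d (specialUnitaryGroup (Fin N) ℂ),
            (∀ l, TwoDim.IsRedSiteLink (P := P) l → U l = V l) → F U = F V) →
          0 ≤ ∫ U, conj (F (configReflect (tiltedUnit d i j (2 * P) (2 * P) L) i
            (tiltedAxisFlip d L (2 * P) hij) U)) * F U
            ∂(gibbs (fundamentalRep (Fin N)) (tiltedUnit d i j (2 * P) (2 * P) L) β)) := by
  haveI : SecondCountableTopology (Matrix (Fin N) (Fin N) ℂ) :=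
    inferInstanceAs (SecondCountableTopology (Fin N → Fin N → ℂ))
  haveI : SecondCountableTopology (specialUnitaryGroup (Fin N) ℂ) :=
    Topology.IsEmbedding.subtypeVal.secondCountableTopology
  exact ⟨fun hd β F hFm hFb hFo => TwoDim.tiltedBox_axisRP_even_twoDim (fundamentalRep (Fin N)) hP hij hd
      (continuous_fundamentalRep (Fin N)) β F hFm hFb hFo,
    fun k hki hkj hL => RedSite.not_tiltedBox_axisRP_even_red_specialUnitary_of_axis (fundamentalRep (Fin N))
      hP hij hki hkj hL (Literature.MathematicalPhysics.QuantumFieldTheory.TorusAreaLaw.isSpecialUnitaryModel_fundamentalRep N) hN⟩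

end ReducedSite

/-! ## The reduced half of the link mirror of the odd box (appended, gen 51) -/

section ReducedLink

variable {d : ℕ} {i j : Fin d} {L P N : ℕ} [NeZero L] [NeZero P]

/-- **`SU(N)` lattice Yang–Mills, the REDUCED half `{1 ≤ x_i ≤ P}` of the link mirror of the odd
box** (`N ≥ 2`, `P ≥ 2`): in `d = 2` (the two axes exhaust `Fin d`) reflection positivity HOLDS at
every real `β`; with a transverse axis `k ∉ {i, j}` (`d ≥ 3`) and `L ≥ 2` it FAILS for all
sufficiently small `β > 0`. [folklore] -/
theorem inPlaneMirrors_reducedLink_suN (hij : i ≠ j) (hP : 2 ≤ P) (hN : 2 ≤ N) :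
    ((∀ k : Fin d, k = i ∨ k = j) → ∀ (β : ℝ)
      (F : Config (TiltedSite d i j (2 * P + 1) (2 * P + 1) L) d (specialUnitaryGroup (Fin N) ℂ) → ℂ), Measurable F →
        (∃ C : ℝ, ∀ U, ‖F U‖ ≤ C) →
        (∀ U V : Config (TiltedSite d i j (2 * P + 1) (2 * P + 1) L) d (specialUnitaryGroup (Fin N) ℂ),
          (∀ l, TwoDim.IsRedLink (P := P) l → U l = V l) → F U = F V) →
        0 ≤ ∫ U, conj (F (configMidReflect (tiltedUnit d i j (2 * P + 1) (2 * P + 1) L) i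
          (tiltedAxisFlip d L (2 * P + 1) hij) U)) * F U
          ∂(gibbs (fundamentalRep (Fin N)) (tiltedUnit d i j (2 * P + 1) (2 * P + 1) L) β)) ∧
    (∀ k : Fin d, k ≠ i → k ≠ j → 2 ≤ L →
      ∃ β₀ : ℝ, 0 < β₀ ∧ ∀ β : ℝ, 0 < β → β ≤ β₀ →
        ¬ ∀ F : Config (TiltedSite d i j (2 * P + 1) (2 * P + 1) L) d (specialUnitaryGroup (Fin N) ℂ) → ℂ,
          Measurable F → (∃ C : ℝ, ∀ U, ‖F U‖ ≤ C) →
          (∀ U V : Config (TiltedSite d i j (2 * P + 1) (2 * P + 1) L) d (specialUnitaryGroup (Fin N) ℂ),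
            (∀ l, TwoDim.IsRedLink (P := P) l → U l = V l) → F U = F V) →
          0 ≤ ∫ U, conj (F (configMidReflect (tiltedUnit d i j (2 * P + 1) (2 * P + 1) L) i
            (tiltedAxisFlip d L (2 * P + 1) hij) U)) * F U
            ∂(gibbs (fundamentalRep (Fin N)) (tiltedUnit d i j (2 * P + 1) (2 * P + 1) L) β)) := by
  haveI : SecondCountableTopology (Matrix (Fin N) (Fin N) ℂ) :=
    inferInstanceAs (SecondCountableTopology (Fin N → Fin N → ℂ))
  haveI : SecondCountableTopology (specialUnitaryGroup (Fin N) ℂ) :=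
    Topology.IsEmbedding.subtypeVal.secondCountableTopology
  exact ⟨fun hd β F hFm hFb hFo => TwoDim.tiltedBox_midAxisRP_odd_twoDim (fundamentalRep (Fin N)) hij hd
      (continuous_fundamentalRep (Fin N)) β F hFm hFb hFo,
    fun k hki hkj hL => RedLink.not_tiltedBox_midAxisRP_odd_red_specialUnitary_of_axis (fundamentalRep (Fin N))
      hP hij hki hkj hL (Literature.MathematicalPhysics.QuantumFieldTheory.TorusAreaLaw.isSpecialUnitaryModel_fundamentalRep N) hN⟩

end ReducedLink

end TiltedRP

end Summit.QuantumFields.GaugeBoot
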